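import Mathlib
import HarnessLib
import Literature.Computability.AlgebraicComplexity.PatternExpressions
import Summits.ValiantsHypothesis.ValiantsHypothesis.Theorems.MonotoneRestorationOrbitCompressionQPSymmetricOfRowGadget

/-!
# Route MonotoneRestoration — aside `OrbitCompressionQP` (stmt-ValiantsHypothesis-18332), line
# `expression_compression`: TWO-LEVEL SYMMETRIC AGGREGATION — `H_n(g_n(row 0), …, g_n(row n-1))`

Nested use of the `VP` mechanism (Bläser–Jindal twice + the `VQP` substitution principle twice): for `VQP`
families of SYMMETRIC polynomials `g_n` (inner, applied to each row) and `H_n` (outer, applied to the vector of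
row values), the matrix-symmetric family `f_n = H_n(g_n(row 0), …, g_n(row n-1))` is narrow of quasi-polynomial
length — e.g. `Π_i (1 + Σ_j x_ij^3)`, `e_k((Π_j (1 + x_ij))_i)`, `Σ_i g_n(row i)^n`.

* `exists_oneRowValue` — the ROW GADGET of a symmetric `VQP` family: a `(1,1)`-label expression of
  quasi-polynomial length whose value at `(ρ, γ)` is `g_n(row ρ 0)` (the open-label half of
  `narrowQP_oneRow`);
* ★★ `narrowQP_twoLevel` — the theorem, by feeding the row gadget to `narrowQP_symmetric_of_rowGadget`.

Helper file (`--supports stmt-ValiantsHypothesis-18332`); def-free; nothing here is a named fact; no registered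
stub is closed; VP ≠ VNP is not moved.
-/

noncomputable section

open MvPolynomial

-- `Summit.ValiantsHypothesis.ValiantsHypothesis.…` is the tree's single-conjunct layout (Sub = Summit).
set_option linter.dupNamespace false

namespace Summit.ValiantsHypothesis.ValiantsHypothesis.Theorems

namespace FormulaSubstitution

open Literature.Computability.AlgebraicComplexity

/-- **The row gadget of a symmetric `VQP` family**: for `n ≥ 1` a `(1,1)`-label expression of
quasi-polynomial length whose value at `(ρ, γ)` is `g_n(x_{ρ 0, 0}, …, x_{ρ 0, n-1})`. [cite: BlaserJindal2019, Thm. 4] -/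
theorem exists_oneRowValue (g : (n : ℕ) → MvPolynomial (Fin n) ℂ) (hsymm : ∀ n, (g n).IsSymmetric)
    (hg : IsVQPFamily g) :
    ∃ c : ℕ, ∀ n : ℕ, 1 ≤ n → ∃ W : PatternExpr ℂ 1 1, W.length ≤ 2 ^ ((Nat.log 2 n + c) ^ c) ∧
      ∀ (ρ γ : Fin 1 → Fin n),
        W.value n ρ γ = aeval (fun v : Fin n => (X (ρ 0, v) : MvPolynomial (Fin n × Fin n) ℂ)) (g n) := by
  classical
  choose P hP using fun n => exists_symmetricCore (g n) (hsymm n)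
  have hPq : IsVQPFamily P := isVQPFamily_symmetricCore g P hP hg
  choose E hE using fun n : ℕ => exists_rowEsymm n n
  have hθ : ∃ c : ℕ, ∀ n : ℕ, 1 ≤ n → ∀ i : Fin n,
      (E n (i.val + 1)).length ≤ 2 ^ ((Nat.log 2 n + c) ^ c) := by
    obtain ⟨c, hc⟩ := esymm_subst_length_qp 1
    refine ⟨c, fun n _ i => ?_⟩
    exact ((hE n (i.val + 1) (by omega)).1.trans (Nat.mul_le_mul_left _ (by omega))).trans
      (hc n n (by simp))
  obtain ⟨c₁, hc₁⟩ := exists_narrow_subst_of_isVQPFamily (m := fun n => n) P hPq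
    (k := fun _ => 1) (l := fun _ => 1) (fun n i => E n (i.val + 1)) hθ
  refine ⟨c₁, fun n hn => ?_⟩
  obtain ⟨e, hl, hv⟩ := hc₁ n hn
  refine ⟨e, hl, fun ρ γ => ?_⟩
  have hfun : (fun j : Fin n => (E n (j.val + 1)).value n ρ γ) =
      fun j : Fin n => aeval (fun v : Fin n => (X (ρ 0, v) : MvPolynomial (Fin n × Fin n) ℂ))
        (esymm (Fin n) ℂ (j.val + 1)) :=
    funext fun j => (hE n (j.val + 1) (by omega)).2 ρ γ
  rw [hv, hfun, ← hP n, ← AlgHom.comp_apply, comp_aeval]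

/-- ★★ **Two-level symmetric aggregation is narrow of quasi-polynomial length.**  For `VQP` families of
symmetric polynomials `g_n` and `H_n` (both in `ℂ[y_0, …, y_{n-1}]^{S_n}`), the family
`f_n = H_n(g_n(row 0), …, g_n(row n-1))` on the `n × n` variable matrix satisfies the conclusion of
`stub_narrowExpressionCompression`. [cite: BlaserJindal2019, Thm. 4] -/
theorem narrowQP_twoLevel (H g : (n : ℕ) → MvPolynomial (Fin n) ℂ)
    (hHsymm : ∀ n, (H n).IsSymmetric) (hH : IsVQPFamily H)
    (hgsymm : ∀ n, (g n).IsSymmetric) (hg : IsVQPFamily g) :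
    ∃ c : ℕ, ∀ n : ℕ, 1 ≤ n → ∃ (k l : ℕ) (e : PatternExpr ℂ k l),
      n ^ (k + l) ≤ 2 ^ ((Nat.log 2 n + c) ^ c) ∧ e.length ≤ 2 ^ ((Nat.log 2 n + c) ^ c) ∧
      e.close n = aeval (fun i : Fin n =>
        aeval (fun v : Fin n => (X (i, v) : MvPolynomial (Fin n × Fin n) ℂ)) (g n)) (H n) := by
  classical
  obtain ⟨c, hc⟩ := exists_oneRowValue g hgsymm hg
  have hW : ∀ n : ℕ, ∃ W : PatternExpr ℂ 1 1, 1 ≤ n → W.length ≤ 2 ^ ((Nat.log 2 n + c) ^ c) ∧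
      ∀ (ρ γ : Fin 1 → Fin n),
        W.value n ρ γ = aeval (fun v : Fin n => (X (ρ 0, v) : MvPolynomial (Fin n × Fin n) ℂ)) (g n) := by
    intro n
    by_cases hn : 1 ≤ n
    · obtain ⟨W, hl, hv⟩ := hc n hn
      exact ⟨W, fun _ => ⟨hl, hv⟩⟩
    · exact ⟨PatternExpr.const 0, fun h1 => absurd h1 hn⟩
  choose W hW' using hW
  exact narrowQP_symmetric_of_rowGadget H hHsymm hH W
    (fun n i => aeval (fun v : Fin n => (X (i, v) : MvPolynomial (Fin n × Fin n) ℂ)) (g n))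
    ⟨c, fun n hn => hW' n hn⟩

/-- The `VP` case. [cite: BlaserJindal2019, Thm. 4] -/
theorem narrowQP_twoLevel_of_VP (H g : (n : ℕ) → MvPolynomial (Fin n) ℂ)
    (hHsymm : ∀ n, (H n).IsSymmetric) (hH : IsVPFamily H)
    (hgsymm : ∀ n, (g n).IsSymmetric) (hg : IsVPFamily g) :
    ∃ c : ℕ, ∀ n : ℕ, 1 ≤ n → ∃ (k l : ℕ) (e : PatternExpr ℂ k l),
      n ^ (k + l) ≤ 2 ^ ((Nat.log 2 n + c) ^ c) ∧ e.length ≤ 2 ^ ((Nat.log 2 n + c) ^ c) ∧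
      e.close n = aeval (fun i : Fin n =>
        aeval (fun v : Fin n => (X (i, v) : MvPolynomial (Fin n × Fin n) ℂ)) (g n)) (H n) :=
  narrowQP_twoLevel H g hHsymm hH.isVQPFamily hgsymm hg.isVQPFamily

end FormulaSubstitution

end Summit.ValiantsHypothesis.ValiantsHypothesis.Theorems

end
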